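import Literature.Analysis.Pluripotential.WeightedLogPolynomialLevelSets
import Literature.Analysis.Pluripotential.HomogeneousPolynomialCurrent
import HarnessLib

/-!
# The currents `Σₖ aₖ [Fₖ = 0]` of effective `ℝ`-divisors on `ℙᴺ(ℂ)` and Siu's theorem for them

Topic `Literature/Analysis/Pluripotential`. For non-zero homogeneous polynomials `F₁, …, F_K` of
degrees `dₖ ≥ 1` in `N + 1` variables and real coefficients `aₖ > 0`, the function
`V = Σₖ (aₖ/dₖ) log |Fₖ|` on `ℂ^{N+1}` is plurisubharmonic, logarithmically homogeneous of degree
`Σₖ aₖ` and `≢ -∞` near every point: it is the cone potential of the closed positive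
`(1,1)`-current `Σₖ (aₖ/dₖ) [Fₖ = 0]` — the current of integration of the effective `ℝ`-divisor
`Σₖ (aₖ/dₖ) {Fₖ = 0}` (Lelong–Poincaré), of degree `Σₖ aₖ`. This file packages it as a
`ClosedPositiveOneOneCurrent N` (`ClosedPositiveOneOneCurrent.ofHomogeneousPolynomials`, a
DEFINITION with body, generalising `ofHomogeneousPolynomial` of
`HomogeneousPolynomialCurrent.lean` to several components) and proves **Siu's theorem for all
these currents**
(`isAnalyticSet_lelongUpperLevelSet_ofHomogeneousPolynomials`): every Lelong upper level set
`E_c(T)`, `c > 0`, is an analytic subset of `ℙᴺ(ℂ)`, by the chart reduction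
(`isAnalyticSet_lelongUpperLevelSet_of_chartPotentials`) and Siu's theorem for weighted sums of
polynomial logarithms on `ℂᴺ` (`isAnalyticSet_lelongUpperLevelSet_sum_const_mul_log_enorm_eval`);
and the Lelong numbers are the weighted multiplicities
(`lelongNumber_ofHomogeneousPolynomials`: `ν(T, x) = Σₖ (aₖ/dₖ) ν(log |Fₖ|, x.rep)
= Σₖ (aₖ/dₖ) mult_x Fₖ`).

## References

* [Siu1974] Y.-T. Siu, Analyticity of sets associated to Lelong numbers and the extension of
  closed positive currents, Invent. Math. 27 (1974): Main Theorem.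
* L. Hörmander, Notions of Convexity (1994), Cor. 4.1.18, Thm. 4.3.3.
* [HormanderSCV1973] L. Hörmander, An introduction to complex analysis in several variables
  (1973), Cor. 1.6.6 and §2.6.
-/

noncomputable section

open scoped Topology ENNReal Manifold ContDiff LinearAlgebra.Projectivization
open MeasureTheory Filter Set Metric MvPolynomial

namespace Literature.Analysis.Pluripotential

/-- Finite sums of plurisubharmonic functions are plurisubharmonic. [cite: HormanderSCV1973,
Thm. 1.6.2] -/
theorem isPlurisubharmonicOn_finset_sum {E : Type*} [NormedAddCommGroup E] [NormedSpace ℂ E]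
    {ι : Type*} (s : Finset ι) {u : ι → E → EReal} {Ω : Set E}
    (h : ∀ i ∈ s, IsPlurisubharmonicOn (u i) Ω) :
    IsPlurisubharmonicOn (fun z ↦ ∑ i ∈ s, u i z) Ω := by
  classical
  induction s using Finset.induction_on with
  | empty => simpa using isPlurisubharmonicOn_const 0 Ω
  | insert a s ha ih =>
    have h1 := (h a (Finset.mem_insert_self a s)).add (ih fun i hi ↦ h i (Finset.mem_insert_of_mem hi))
    convert h1 using 1
    funext z
    rw [Pi.add_apply, Finset.sum_insert ha]

namespace ClosedPositiveOneOneCurrent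

variable {N K : ℕ}

/-- **The current `Σₖ (aₖ/dₖ)[Fₖ = 0]` of an effective `ℝ`-divisor** on `ℙᴺ(ℂ)`: for non-zero
homogeneous polynomials `Fₖ` of degrees `dₖ ≥ 1` and coefficients `aₖ > 0`, the closed positive
`(1,1)`-current with cone potential `V = Σₖ (aₖ/dₖ) log |Fₖ|` and degree `Σₖ aₖ`.
[cite: HormanderSCV1973, Cor. 1.6.6 and §2.6; folklore (Lelong–Poincaré)] -/
def ofHomogeneousPolynomials (F : Fin K → MvPolynomial (Fin (N + 1)) ℂ) (d : Fin K → ℕ)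
    (hF : ∀ k, (F k).IsHomogeneous (d k)) (hd : ∀ k, 0 < d k) (hF0 : ∀ k, F k ≠ 0)
    (a : Fin K → ℝ) (ha : ∀ k, 0 < a k) : ClosedPositiveOneOneCurrent N where
  pot v := ∑ k, ((a k / d k : ℝ) : EReal) * ENNReal.log ‖eval v (F k)‖ₑ
  degree := ∑ k, a k
  degree_nonneg := Finset.sum_nonneg fun k _ ↦ (ha k).le
  isPlurisubharmonicOn_pot :=
    (isPlurisubharmonicOn_finset_sum Finset.univ fun k _ ↦
      (isPlurisubharmonicOn_log_enorm_mvPolynomial_eval (F k)).const_mul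
        (div_nonneg (ha k).le (Nat.cast_nonneg (d k)))).mono (subset_univ _)
  isLogHomogeneous_pot c v hc _ := by
    show ∑ k, ((a k / d k : ℝ) : EReal) * ENNReal.log ‖eval (c • v) (F k)‖ₑ =
      ∑ k, ((a k / d k : ℝ) : EReal) * ENNReal.log ‖eval v (F k)‖ₑ +
        (((∑ k, a k) * Real.log ‖c‖ : ℝ) : EReal)
    simp_rw [const_mul_log_enorm_eval_smul (hF _) (hd _) (ha _).le hc v]
    rw [Finset.sum_add_distrib, Finset.sum_mul, EReal.coe_finsetSum]
  frequently_ne_bot v _ := by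
    have hprod : ∏ k, F k ≠ 0 := Finset.prod_ne_zero_iff.2 fun k _ ↦ hF0 k
    refine (frequently_eval_ne_zero hprod v).mono fun y hy ↦ ?_
    rw [map_prod] at hy
    have hyk : ∀ k, eval y (F k) ≠ 0 := fun k ↦ (Finset.prod_ne_zero_iff.1 hy) k (Finset.mem_univ k)
    have : ∑ k, ((a k / d k : ℝ) : EReal) * ENNReal.log ‖eval y (F k)‖ₑ =
        ((∑ k, a k / d k * Real.log ‖eval y (F k)‖ : ℝ) : EReal) := by
      rw [EReal.coe_finsetSum]
      refine Finset.sum_congr rfl fun k _ ↦ ?_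
      rw [log_enorm_eq_coe (hyk k), ← EReal.coe_mul]
    rw [this]
    exact EReal.coe_ne_bot _

/-- The cone potential of `Σₖ (aₖ/dₖ)[Fₖ = 0]`. [folklore] -/
@[simp] theorem ofHomogeneousPolynomials_pot (F : Fin K → MvPolynomial (Fin (N + 1)) ℂ)
    (d : Fin K → ℕ) (hF : ∀ k, (F k).IsHomogeneous (d k)) (hd : ∀ k, 0 < d k)
    (hF0 : ∀ k, F k ≠ 0) (a : Fin K → ℝ) (ha : ∀ k, 0 < a k) (v : Fin (N + 1) → ℂ) :
    (ofHomogeneousPolynomials F d hF hd hF0 a ha).pot v =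
      ∑ k, ((a k / d k : ℝ) : EReal) * ENNReal.log ‖eval v (F k)‖ₑ := rfl

/-- The degree of `Σₖ (aₖ/dₖ)[Fₖ = 0]` is `Σₖ aₖ`. [folklore] -/
@[simp] theorem degree_ofHomogeneousPolynomials (F : Fin K → MvPolynomial (Fin (N + 1)) ℂ)
    (d : Fin K → ℕ) (hF : ∀ k, (F k).IsHomogeneous (d k)) (hd : ∀ k, 0 < d k)
    (hF0 : ∀ k, F k ≠ 0) (a : Fin K → ℝ) (ha : ∀ k, 0 < a k) :
    (ofHomogeneousPolynomials F d hF hd hF0 a ha).degree = ∑ k, a k := rfl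

/-- **The Lelong numbers of `Σₖ (aₖ/dₖ)[Fₖ = 0]` are the weighted multiplicities**:
`ν(T, x) = Σₖ (aₖ/dₖ) ν(log |Fₖ|, x.rep)` (`= Σₖ (aₖ/dₖ) mult_x Fₖ`).
[cite: Siu1974, Main Theorem; Hörmander, Notions of Convexity, Cor. 4.1.18] -/
theorem lelongNumber_ofHomogeneousPolynomials (F : Fin K → MvPolynomial (Fin (N + 1)) ℂ)
    (d : Fin K → ℕ) (hF : ∀ k, (F k).IsHomogeneous (d k)) (hd : ∀ k, 0 < d k)
    (hF0 : ∀ k, F k ≠ 0) (a : Fin K → ℝ) (ha : ∀ k, 0 < a k) (x : ℙ ℂ (Fin (N + 1) → ℂ)) :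
    (ofHomogeneousPolynomials F d hF hd hF0 a ha).lelongNumber x =
      ∑ k, a k / d k *
        Pluripotential.lelongNumber (fun z : Fin (N + 1) → ℂ ↦ ENNReal.log ‖eval z (F k)‖ₑ) x.rep := by
  show Pluripotential.lelongNumber (ofHomogeneousPolynomials F d hF hd hF0 a ha).pot x.rep = _
  exact lelongNumber_sum_const_mul_log_enorm_eval F hF0 (fun k ↦ a k / d k)
    (fun k ↦ div_pos (ha k) (Nat.cast_pos.2 (hd k))) (Nat.succ_le_succ (Nat.zero_le N)) x.rep

/-- **Siu's theorem for the currents of effective `ℝ`-divisors `Σₖ (aₖ/dₖ)[Fₖ = 0]`**: every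
Lelong upper level set `E_c(T)` (`c` real; `= ℙᴺ` for `c ≤ 0`) is an analytic subset of `ℙᴺ(ℂ)`.
Proof: reduction to
the affine charts, where the chart potentials are the weighted sums `Σₖ (aₖ/dₖ) log |gₖᵢ|` of
logarithms of the (non-zero) chart restrictions `gₖᵢ`, and Siu's theorem for such sums on `ℂᴺ`;
`ℙ⁰` is a point. [cite: Siu1974, Main Theorem (currents of integration of divisors)] -/
theorem isAnalyticSet_lelongUpperLevelSet_ofHomogeneousPolynomials
    (F : Fin K → MvPolynomial (Fin (N + 1)) ℂ) (d : Fin K → ℕ) (hF : ∀ k, (F k).IsHomogeneous (d k))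
    (hd : ∀ k, 0 < d k) (hF0 : ∀ k, F k ≠ 0) (a : Fin K → ℝ) (ha : ∀ k, 0 < a k) (c : ℝ) :
    Literature.Geometry.Kaehler.IsAnalyticSet 𝓘(ℂ, Fin N → ℂ)
      ((ofHomogeneousPolynomials F d hF hd hF0 a ha).lelongUpperLevelSet c) := by
  rcases Nat.eq_zero_or_pos N with hN | hN
  · subst hN
    haveI := subsingleton_projectivization_fin_one
    exact isAnalyticSet_of_subsingleton _ _
  · refine (ofHomogeneousPolynomials F d hF hd hF0 a ha).isAnalyticSet_lelongUpperLevelSet_of_chartPotentials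
      hN fun i ↦ ?_
    set g : Fin K → MvPolynomial (Fin N) ℂ := fun k ↦
      aeval (Fin.insertNth i (1 : MvPolynomial (Fin N) ℂ) X) (F k) with hg
    have hg0 : ∀ k, g k ≠ 0 := fun k ↦ aeval_insertNth_ne_zero (hF k) (hF0 k) i
    have hfun : (fun w' : Fin N → ℂ ↦
        (ofHomogeneousPolynomials F d hF hd hF0 a ha).pot (Fin.insertNth i 1 w')) =
        fun w' ↦ ∑ k, ((a k / d k : ℝ) : EReal) * ENNReal.log ‖eval w' (g k)‖ₑ := by
      funext w'
      rw [ofHomogeneousPolynomials_pot]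
      refine Finset.sum_congr rfl fun k _ ↦ ?_
      rw [hg]
      simp only
      rw [eval_aeval_insertNth]
    rw [hfun]
    exact isAnalyticSet_lelongUpperLevelSet_sum_const_mul_log_enorm_eval g hg0 (fun k ↦ a k / d k)
      (fun k ↦ div_pos (ha k) (Nat.cast_pos.2 (hd k))) hN c

end ClosedPositiveOneOneCurrent

end Literature.Analysis.Pluripotential

end
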